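import Summits.BirchSwinnertonDyer.BirchSwinnertonDyer.Theorems.ByReductionTypeAtTwoAdditiveQuadraticPotGoodOneSided
import HarnessLib

/-!
# Crux `AdditiveRankZeroAtTwo` (K4 item 19098): DOORS INTO THE EISENSTEIN HALF `MissingLowerBoundAt W 2` on the additive
# potentially-good class (the planner's v2.2 child C3″ `AdditivePotGoodLowerHalfAtTwo` = binder `hLow` of
# `additiveRankZeroAtTwo_of_residual_v4`) from ONE-SIDED over-`K` objects — seat `bsd-2adic-addL2x` GEN 11

Cell `bsd-2adic`, rung K4, crux stmt-BirchSwinnertonDyer-19098, line add_twist_overK v2. `--supports 19098 --as helper`.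
HONEST FRAMING (D-0036/D-0054): conditional theorems; every research-grade input displayed; closes nothing at the
`∀`-level; nothing booked; BSD is not proved by any of this.

WHAT THIS FILE DOES. Glue v4 (p627985) displays the Eisenstein half over `ℚ` on the additive potentially-good `r_an = 0`
class (`hLow`). The cell's two over-`K` roads reach it ONE-SIDEDLY:
* §1 `missingLowerBoundAt_of_lowerOverC_of_upper_twist` — the MIXED one-sided form of the pair identity
  `def(V) = def(W) + def(Wd)` (`AdditivePotMult.shaAnOverC_mul_eq`, any `p`, any quadratic `K`, any `K`-model `V` of `W_K`,
  `Wd` a model of `W^{(d_K)}`): the LOWER half over `K` on `V` and the UPPER half over `ℚ` at the twist `Wd` give the LOWER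
  half over `ℚ` at `W`. `lower_of_lowerOverKC_of_upper_twist` — the canonical model `W.baseChange K`, Milne any-model
  (`hMilneC`) and GZK finiteness discharged.
* §2 `addDefect_lower_of_upper_of_lowerOverKC_of_murtyMurty` — on the defect-`≥ 3` block: the Eisenstein half over `ℚ`
  from the KATO HALF on the block (applied at the Murty–Murty INERT twist, which stays in the block) and the LOWER half
  over the inert field `MissingLowerBoundOverCAt (W.baseChange K) 2` (= GEN 0's `stub_addDefectOverKC` made one-sided).
  `addQuadPotGood_lower_of_goodSiblings_of_lowerOverKC` — on the `C₂` sub-class: the Eisenstein half over `ℚ` from the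
  GOOD sibling cruxes at the Hoffstein–Luo twist and the LOWER half over the ramified field (lane A's stub one-sided);
  no Kato half needed there.
* §3 `addPotGoodLower_two_of_kato_of_lowerOverK` — C3″'s body VERBATIM («`¬CM → r_an = 0 → Addv W 2 → 0 ≤ ord₂ j →
  MissingLowerBoundAt W 2`») from PRINT + READINGS + siblings {19095, 19097} + the Kato-half residuals (I1″) `hAna`,
  (I2″) `hRest` + the two ONE-SIDED over-`K` objects `hKClow` (inert, defect ≥ 3) and `hQKlow` (ramified, `C₂`).

References: [Milne1972ArithmeticAV] §1 Thm. 1 (through [DokchitserDokchitserAnnals2010] §2.1); [MurtyMurty1997] Ch. 6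
Thm. 1.2; [HoffsteinLuo1997]; [Kato2004Asterisque] Thm. 12.5, Prop. 14.16 (2); [CoatesSujatha2005] statement (A);
[Miller2011LMS] Def. 1.1.
-/

set_option autoImplicit false
set_option linter.dupNamespace false

noncomputable section

open scoped Classical

namespace Summit.BirchSwinnertonDyer.BirchSwinnertonDyer.Theorems.AddKatoTwo

open WeierstrassCurve Literature.NumberTheory.EllipticCurves
  Literature.NumberTheory.EllipticCurves.ModularForms
  Literature.NumberTheory.EllipticCurves.Kato2004
  Literature.NumberTheory.EllipticCurves.Rank1Residual
  Literature.NumberTheory.EllipticCurves.Rank1Residual.Typed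
  Literature.NumberTheory.IwasawaTheory
  Summit.BirchSwinnertonDyer.Rank1Residual Summit.BirchSwinnertonDyer.Rank1Residual.AdditivePotMult
  Summit.BirchSwinnertonDyer.Rank1Residual.X5.AddTwoL2
  Summit.BirchSwinnertonDyer.BirchSwinnertonDyer.Theses.ByReductionTypeAtTwo

/-! ## §1 The mixed one-sided pair identity: lower over `K` + upper at the twist ⇒ lower over `ℚ` -/

section Mixed

variable (W : WeierstrassCurve ℚ) [W.IsElliptic] (p : ℕ) [Fact p.Prime]
  (K : Type) [Field K] [NumberField K]
  (Wd : WeierstrassCurve ℚ) [Wd.IsElliptic] (V : WeierstrassCurve K) [V.IsElliptic]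

/-- **Lower half over `K` + upper half at the twist ⇒ lower half over `ℚ`** (any prime `p`, any quadratic `K`, any
`K`-model `V` of `W_K`, `Wd` a model of `W^{(d_K)}`; hypotheses of (★) `AdditivePotMult.shaAnOverC_mul_eq`: modularity,
`[K:ℚ] = 2`, the three `Ш` finite, the model-free Weil-restriction identity `hWR`). With `#Ш_an(V) = q'`,
`#Ш_an(Wd) = q_d` rational, `#Ш_an(W)` is the rational `q = q'·#Ш(W)·#Ш(Wd)/(q_d·#Ш(V))` (`exists_shaAn_eq_of_overC`), so
`def(W) = def(V) − def(Wd)` for the defects `def(X) = ord_p #Ш_an(X) − ord_p #Ш(X)`; `def(V) ≤ 0` (lower over `K`) and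
`def(Wd) ≥ 0` (upper at the twist) give `def(W) ≤ 0`. The mixed twin of GEN 0's `missingPPartAt_pair_of_overC_of_upper_upper`.
[cite: Milne1972ArithmeticAV, §1 Thm. 1 (through DokchitserDokchitserAnnals2010 §2.1)] [cite: Miller2011LMS, Def. 1.1] -/
theorem missingLowerBoundAt_of_lowerOverC_of_upper_twist (hmod : hasEntireLFunction_rat)
    (h2 : Module.finrank ℚ K = 2)
    (hWd : ∃ C : VariableChange ℚ, C • W.quadraticTwist (NumberField.discr K : ℚ) = Wd)
    (hV : ∃ C : VariableChange K, C • W.baseChange K = V)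
    (hshaW : W.ShaFinite) (hshaD : Wd.ShaFinite) (hshaK : V.ShaFinite)
    (hWR : (V.shaOrder : ℝ) * V.regulator * V.bsdPeriod * (V.modifiedTamagawaProduct : ℝ) /
        (V.torsionOrder : ℝ) ^ 2 = W.bsdRHS * Wd.bsdRHS)
    (hK : MissingLowerBoundOverCAt V p) (hud : MissingUpperBoundAt Wd p) : MissingLowerBoundAt W p := by
  obtain ⟨q', hq', hv'⟩ := hK
  obtain ⟨qd, hqd, hled⟩ := hud
  have hq := exists_shaAn_eq_of_overC W K Wd V hmod h2 hWd hV hshaW hshaD hshaK hWR hq' hqd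
  refine ⟨_, hq, ?_⟩
  have hsW : W.shaOrder ≠ 0 := (W.shaOrder_pos hshaW).ne'
  have hsD : Wd.shaOrder ≠ 0 := (Wd.shaOrder_pos hshaD).ne'
  have hsK : V.shaOrder ≠ 0 := (V.shaOrder_pos hshaK).ne'
  have hsWq : (W.shaOrder : ℚ) ≠ 0 := by exact_mod_cast hsW
  have hsDq : (Wd.shaOrder : ℚ) ≠ 0 := by exact_mod_cast hsD
  have hsKq : (V.shaOrder : ℚ) ≠ 0 := by exact_mod_cast hsK
  have hqd0 : qd ≠ 0 := by
    intro h0; apply shaAn_ne_zero Wd hmod; rw [hqd, h0, Rat.cast_zero]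
  have hq'0 : q' ≠ 0 := by
    intro h0
    apply shaAn_ne_zero W hmod
    rw [hq, h0]
    push_cast
    ring
  rw [padicValRat.div (mul_ne_zero (mul_ne_zero hq'0 hsWq) hsDq) (mul_ne_zero hqd0 hsKq),
    padicValRat.mul (mul_ne_zero hq'0 hsWq) hsDq, padicValRat.mul hq'0 hsWq, padicValRat.mul hqd0 hsKq,
    padicValRat.of_nat, padicValRat.of_nat, padicValRat.of_nat]
  push_cast at hv' hled ⊢
  linarith

omit [W.IsElliptic] in
/-- **Canonical model, Milne and GZK discharged**: for `W/ℚ` globally minimal of analytic rank `≤ 1`, `K` quadratic, `Wd` a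
globally minimal model of `W^{(d_K)}` of analytic rank `≤ 1`: `MissingLowerBoundOverCAt (W.baseChange K) p` and
`MissingUpperBoundAt Wd p` give `MissingLowerBoundAt W p` (the model-free identity and the finiteness of `Ш(E_K)` from
`hMilneC`, finiteness over `ℚ` from `hGZK`). [cite: Milne1972ArithmeticAV, §1 Thm. 1 (through DokchitserDokchitserAnnals2010 §2.1)] -/
theorem lower_of_lowerOverKC_of_upper_twist [W.IsElliptic] [W.IsGloballyMinimal] [Wd.IsGloballyMinimal]
    (hGZK : rank_eq_analyticRank_of_analyticRank_le_one) (hmod : hasEntireLFunction_rat)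
    (hMilneC : Milne1972.bsdQuotient_baseChange_quadratic_anyModel)
    (hr : W.analyticRank ≤ 1) (h2 : Module.finrank ℚ K = 2)
    (hWd : ∃ C : VariableChange ℚ, C • W.quadraticTwist (NumberField.discr K : ℚ) = Wd)
    (hrd : Wd.analyticRank ≤ 1) (hK : MissingLowerBoundOverCAt (W.baseChange K) p)
    (hud : MissingUpperBoundAt Wd p) : MissingLowerBoundAt W p := by
  haveI : (W.baseChange K).IsElliptic := by rw [baseChange]; infer_instance
  have hV : ∃ C : VariableChange K, C • W.baseChange K = W.baseChange K := ⟨1, one_smul _ _⟩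
  obtain ⟨-, hfinW⟩ := hGZK W hr
  obtain ⟨-, hfinD⟩ := hGZK Wd hrd
  obtain ⟨hshaK, hWR⟩ := hMilneC W K h2 Wd hWd (W.baseChange K) hV hfinW hfinD
  exact missingLowerBoundAt_of_lowerOverC_of_upper_twist W p K Wd (W.baseChange K) hmod h2 hWd hV hfinW hfinD hshaK
    hWR hK hud

end Mixed

/-! ## §2 The two over-`K` roads reach the Eisenstein half over `ℚ` ONE-SIDEDLY -/

/-- **Defect-`≥ 3` block: the Eisenstein half over `ℚ` from the Kato half on the block and the LOWER half over the
INERT field.** Granted PRINT {`hGZK`, `hmod`, `hMilneC`, `hMM`}: if the UPPER half holds on the block (`hU3` — after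
p627985 §2 = PRINT + READINGS + (I1″) + (I2″) restricted to the block) and, for every block curve `W` and every quadratic
`K` with `d_K ≡ 5 (mod 8)` and `L(W^{(d_K)},1) ≠ 0`, the LOWER half of the `2`-part of BSD holds for `W.baseChange K`
(`hKClow` — GEN 0's `stub_addDefectOverKC` made ONE-SIDED), then `MissingLowerBoundAt W 2` on the block. Proof:
Murty–Murty's inert `K`; a minimal model `Wd` of the twist is non-CM, `r_an = 0` and again of defect `≥ 3`
(`defectAtLeastThree_of_smul_quadraticTwist_of_emod_four_eq_one`), so `hU3` gives the upper half at `Wd`; §1.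
[cite: MurtyMurty1997, Ch. 6 Thm. 1.2 with the deduction of Thm. 1.1 (pp. 93–94, 96)]
[cite: Milne1972ArithmeticAV, §1 Thm. 1 (through DokchitserDokchitserAnnals2010 §2.1)] -/
theorem addDefect_lower_of_upper_of_lowerOverKC_of_murtyMurty
    (hGZK : rank_eq_analyticRank_of_analyticRank_le_one) (hmod : hasEntireLFunction_rat)
    (hMilneC : Milne1972.bsdQuotient_baseChange_quadratic_anyModel)
    (hMM : murtyMurty_exists_twist_ne_zero_prescribedAtTwo)
    (hU3 : ∀ (W : WeierstrassCurve ℚ) [W.IsElliptic] [W.IsGloballyMinimal],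
      ¬ W.HasCM → W.analyticRank = 0 → DefectAtLeastThree W → MissingUpperBoundAt W 2)
    (hKClow : ∀ (W : WeierstrassCurve ℚ) [W.IsElliptic] [W.IsGloballyMinimal],
      ¬ W.HasCM → W.analyticRank = 0 → DefectAtLeastThree W →
      ∀ (K : Type) [Field K] [NumberField K], Module.finrank ℚ K = 2 → TwoInert K →
        (W.quadraticTwist (NumberField.discr K : ℚ)).entireLFunction 1 ≠ 0 →
        MissingLowerBoundOverCAt (W.baseChange K) 2) :
    ∀ (W : WeierstrassCurve ℚ) [W.IsElliptic] [W.IsGloballyMinimal],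
      ¬ W.HasCM → W.analyticRank = 0 → DefectAtLeastThree W → MissingLowerBoundAt W 2 := by
  intro W _ _ hcm hr hdef
  haveI : Fact (Nat.Prime 2) := ⟨Nat.prime_two⟩
  obtain ⟨K, _, _, h2, hin, hL⟩ := existsNonvanishingInertTwist_of_murtyMurty hMM W
  have hd : (NumberField.discr K : ℚ) ≠ 0 := by exact_mod_cast NumberField.discr_ne_zero K
  haveI := W.isElliptic_quadraticTwist hd
  obtain ⟨C, hCmin⟩ := hasGlobalMinimalModel_rat_holds (W.quadraticTwist (NumberField.discr K : ℚ))
  haveI : (C • W.quadraticTwist (NumberField.discr K : ℚ)).IsGloballyMinimal := hCmin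
  set Wd := C • W.quadraticTwist (NumberField.discr K : ℚ) with hWd_def
  have hWd : ∃ C' : VariableChange ℚ, C' • W.quadraticTwist (NumberField.discr K : ℚ) = Wd := ⟨C, rfl⟩
  have hcmd : ¬ Wd.HasCM := by
    intro h
    apply hcm
    have h1 : (W.quadraticTwist (NumberField.discr K : ℚ)).HasCM :=
      (hasCM_iff_of_j_eq ((W.quadraticTwist (NumberField.discr K : ℚ)).variableChange_j C)).mp h
    exact (hasCM_iff_of_j_eq (W.j_quadraticTwist hd)).mp h1
  have hrd : Wd.analyticRank = 0 := by
    rw [hWd_def, analyticRank_smul]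
    exact analyticRank_eq_zero_of_entireLFunction_one_ne_zero hL
  have hin4 : NumberField.discr K % 4 = 1 := by
    have h5 : NumberField.discr K % 8 = 5 := hin
    omega
  have hdefd : DefectAtLeastThree Wd :=
    defectAtLeastThree_of_smul_quadraticTwist_of_emod_four_eq_one W Wd hin4 rfl hdef
  exact lower_of_lowerOverKC_of_upper_twist W 2 K Wd hGZK hmod hMilneC (by omega) h2 hWd (by omega)
    (hKClow W hcm hr hdef K h2 hin hL) (hU3 Wd hcmd hrd hdefd)

/-- **`C₂` sub-class: the Eisenstein half over `ℚ` from the GOOD sibling cruxes at the Hoffstein–Luo twist and the LOWER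
half over the ramified field** — no Kato half needed here. Granted PRINT {`hGZK`, `hmod`, `hMilneC`, `hHL`} + `hOrd` (19095)
+ `hSS` (19097): if for every `C₂`-curve `W` and every quadratic `K` with `W^{(d_K)}` semistable at `2` and
`L(W^{(d_K)},1) ≠ 0` the LOWER half of the `2`-part of BSD holds for `W.baseChange K` (`hQKlow`, lane A's stub one-sided),
then `MissingLowerBoundAt W 2` on the `C₂` sub-class (`addTwist_lower_of_lowerOverKC` with `BSD₂(Wd)` from the good
siblings, the twist being good by `good_of_semistableTwist_of_padicValRat_j_nonneg`).
[cite: Milne1972ArithmeticAV, §1 Thm. 1] [cite: HoffsteinLuo1997, Theorem] -/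
theorem addQuadPotGood_lower_of_goodSiblings_of_lowerOverKC
    (hGZK : rank_eq_analyticRank_of_analyticRank_le_one) (hmod : hasEntireLFunction_rat)
    (hMilneC : Milne1972.bsdQuotient_baseChange_quadratic_anyModel)
    (hHL : HoffsteinLuo1997_exists_twist_L_one_ne_zero)
    (hOrd : GoodOrdinaryRankZeroAtTwo) (hSS : SupersingularRankZeroAtTwo)
    (hQKlow : ∀ (W : WeierstrassCurve ℚ) [W.IsElliptic] [W.IsGloballyMinimal], ¬ W.HasCM → W.analyticRank = 0 →
      Addv W 2 → 0 ≤ padicValRat 2 W.j → ∀ (K : Type) [Field K] [NumberField K], Module.finrank ℚ K = 2 →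
        SemistableTwistAtTwo W K → (W.quadraticTwist (NumberField.discr K : ℚ)).entireLFunction 1 ≠ 0 →
          MissingLowerBoundOverCAt (W.baseChange K) 2) :
    ∀ (W : WeierstrassCurve ℚ) [W.IsElliptic] [W.IsGloballyMinimal], ¬ W.HasCM → W.analyticRank = 0 →
      Addv W 2 → 0 ≤ padicValRat 2 W.j → QuadSemistabilisable W → MissingLowerBoundAt W 2 := by
  intro W _ _ hcm hr hadd hj hq
  haveI : Fact (Nat.Prime 2) := ⟨Nat.prime_two⟩
  obtain ⟨K, _, _, h2, hst, hL⟩ := Theorems.existsSemistabilisingNonvanishingTwist_of_hoffsteinLuo hHL W hq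
  obtain ⟨Wd, _, _, hWd, hcmd, hrd, hred⟩ := Theorems.exists_minimalTwist_semistable_rankZero W hcm K hst hL
  have hdK : (NumberField.discr K : ℚ) ≠ 0 := by exact_mod_cast NumberField.discr_ne_zero K
  have hd : BSDp Wd 2 := by
    rcases good_of_semistableTwist_of_padicValRat_j_nonneg W hj hdK Wd hWd hred with hgo | hss
    · exact hOrd Wd hcmd hrd hgo
    · exact hSS Wd hcmd hrd hss
  exact addTwist_lower_of_lowerOverKC W 2 K Wd hGZK hmod hMilneC (by rw [hr]; exact zero_le_one) h2 hWd
    (by rw [hrd]; exact zero_le_one) (hQKlow W hcm hr hadd hj K h2 hst hL) hd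

/-! ## §3 C3″ `AdditivePotGoodLowerHalfAtTwo` from the Kato-half residuals and the two ONE-SIDED over-`K` objects -/

/-- **The Eisenstein half on the additive potentially-good class (the body of the v2.2 child C3″ VERBATIM) from ONE-SIDED
over-`K` objects.** GRANTED — PRINT {`hGZK`, `hmod`, `hmodN`, `hMilneC`, `hHL`, `hMM`, `hLim2`, `hFW`, `hCassels`, `hCT`} +
READINGS {`hSharp`, `hin`} + siblings {`hOrd`, `hSS`} + the Kato-half residuals (I1″) `hAna`, (I2″) `hRest` (as in
`addPotGoodUpper_two_of_conjA_of_rest`) + `hKClow` (LOWER half over every admissible INERT quadratic field on the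
defect-`≥ 3` block) + `hQKlow` (LOWER half over every admissible twist-semistabilising quadratic field on the `C₂`
sub-class): for every non-CM globally minimal `W` of analytic rank `0`, additive at `2` with `0 ≤ ord₂ j`,
`MissingLowerBoundAt W 2`. Split on `QuadSemistabilisable W` (§2); on the defect-`≥ 3` side the Kato half of p627985 §2
feeds `hU3` (`0 ≤ ord₂ j` on the block: not quadratically semistabilisable ⇒ not potentially multiplicative). Conditional;
closes nothing. [cite: MurtyMurty1997, Ch. 6 Thm. 1.2] [cite: HoffsteinLuo1997, Theorem] [cite: Milne1972ArithmeticAV, §1 Thm. 1]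
[cite: Kato2004Asterisque, Thm. 12.5 (1)(3), Prop. 14.16 (2)] [cite: CoatesSujatha2005, statement (A)] [cite: Miller2011LMS, Def. 1.1] -/
theorem addPotGoodLower_two_of_kato_of_lowerOverK
    (hGZK : rank_eq_analyticRank_of_analyticRank_le_one) (hmod : hasEntireLFunction_rat) (hmodN : exists_isNewformOf)
    (hMilneC : Milne1972.bsdQuotient_baseChange_quadratic_anyModel)
    (hHL : HoffsteinLuo1997_exists_twist_L_one_ne_zero)
    (hMM : murtyMurty_exists_twist_ne_zero_prescribedAtTwo)
    (hLim2 : Lim2017.thm35_at_two_fineSelmerDual_moduleFinite_of_classicalMuVanishes_of_le_divisionField_four)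
    (hFW : ferreroWashington1979_classicalMuVanishes)
    (hCassels : bsdRHS_eq_of_isIsogenous) (hCT : exists_casselsTate_pairing (K := ℚ))
    (hSharp : Kato2004.rankZero_padicValNat_sha_add_padicValNat_tamagawa_le_at_two_of_irreducible_of_fineSelmerDual_fg)
    (hin : Kato2004.exists_memberHullInputs_two)
    (hOrd : GoodOrdinaryRankZeroAtTwo) (hSS : SupersingularRankZeroAtTwo)
    (hAna : ∀ (W : WeierstrassCurve ℚ) [W.IsElliptic] [W.IsGloballyMinimal], ¬ W.HasCM → W.analyticRank = 0 →
      Addv W 2 → 0 ≤ padicValRat 2 W.j → ¬ IsAbelianGalois ℚ (W.divisionField 2) →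
      ∀ (κ : ZpExtension ℚ 2), κ.IsCyclotomic →
        ∃ (γ : Field.absoluteGaloisGroup ℚ) (D : W.FineSelmerDualData κ γ),
          Module.Finite ℤ_[2] (RestrictScalars ℤ_[2] (IwasawaAlgebra 2) D.X))
    (hRest : ∀ (W : WeierstrassCurve ℚ) [W.IsElliptic] [W.IsGloballyMinimal], ¬ W.HasCM → W.analyticRank = 0 →
      Addv W 2 → 0 ≤ padicValRat 2 W.j → ¬ W.HasIrreducibleModPGaloisRep 2 →
      ¬ ((∀ (W' : WeierstrassCurve ℚ) [W'.IsElliptic], IsIsogenous W W' → ¬ 2 ^ 2 ∣ W'.torsionOrder) ∧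
          (∀ q : ℚ, shaAn W = (q : ℂ) → Even (padicValRat 2 q))) →
      MissingUpperBoundAt W 2)
    (hKClow : ∀ (W : WeierstrassCurve ℚ) [W.IsElliptic] [W.IsGloballyMinimal],
      ¬ W.HasCM → W.analyticRank = 0 → DefectAtLeastThree W →
      ∀ (K : Type) [Field K] [NumberField K], Module.finrank ℚ K = 2 → TwoInert K →
        (W.quadraticTwist (NumberField.discr K : ℚ)).entireLFunction 1 ≠ 0 →
        MissingLowerBoundOverCAt (W.baseChange K) 2)
    (hQKlow : ∀ (W : WeierstrassCurve ℚ) [W.IsElliptic] [W.IsGloballyMinimal], ¬ W.HasCM → W.analyticRank = 0 →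
      Addv W 2 → 0 ≤ padicValRat 2 W.j → ∀ (K : Type) [Field K] [NumberField K], Module.finrank ℚ K = 2 →
        SemistableTwistAtTwo W K → (W.quadraticTwist (NumberField.discr K : ℚ)).entireLFunction 1 ≠ 0 →
          MissingLowerBoundOverCAt (W.baseChange K) 2) :
    ∀ (W : WeierstrassCurve ℚ) [W.IsElliptic] [W.IsGloballyMinimal], ¬ W.HasCM → W.analyticRank = 0 →
      Addv W 2 → 0 ≤ padicValRat 2 W.j → MissingLowerBoundAt W 2 := by
  intro W _ _ hcm hr hadd hj
  haveI : Fact (Nat.Prime 2) := ⟨Nat.prime_two⟩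
  by_cases hq : QuadSemistabilisable W
  · exact addQuadPotGood_lower_of_goodSiblings_of_lowerOverKC hGZK hmod hMilneC hHL hOrd hSS hQKlow W hcm hr hadd hj hq
  · -- defect ≥ 3: the Kato half of p627985 §2 on the block (`0 ≤ ord₂ j` there: not potentially multiplicative)
    have hU3 : ∀ (W : WeierstrassCurve ℚ) [W.IsElliptic] [W.IsGloballyMinimal],
        ¬ W.HasCM → W.analyticRank = 0 → DefectAtLeastThree W → MissingUpperBoundAt W 2 := by
      intro W' _ _ hcm' hr' hdef'
      have hj' : 0 ≤ padicValRat 2 W'.j := by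
        by_contra hlt
        exact hdef'.2 (quadSemistabilisable_of_potMult W' ⟨hdef'.1, lt_of_not_ge hlt⟩)
      exact addPotGoodUpper_two_of_conjA_of_rest hGZK hmod hmodN hLim2 hFW hCassels hCT hSharp hin hAna hRest W' hcm'
        hr' hdef'.1 hj'
    exact addDefect_lower_of_upper_of_lowerOverKC_of_murtyMurty hGZK hmod hMilneC hMM hU3 hKClow W hcm hr ⟨hadd, hq⟩

end Summit.BirchSwinnertonDyer.BirchSwinnertonDyer.Theorems.AddKatoTwo

end
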